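import Mathlib
import Literature.Analysis.ODE.SchrodingerODE
import Literature.Analysis.ODE.InverseSquareTailOperator

/-!
# Crux `UniformPhotonSphereChannelsR` (K1R, stmt-FinalStateConjecture-14074), line
# `crum-peeling-recessive-tower` — stub E (`stub_ladderExists`), helper 2: the recessive chain

Support file (ODE, no definitions) for `stub_ladderExists` — existence of the recessive
Riccati/Crum ladder of the Regge–Wheeler potential.  Everything is GLOBAL on `ℝ` and proved for an
abstract continuous potential; the Regge–Wheeler potential enters only in the assembly file.

* `reduction_step` (d'Alembert's reduction of order at `+∞`).  Let `v` be a zero-free global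
  solution of `v'' = Q v` with `x v'/v → μ`, `μ > 1/2` (so `v⁻²` is integrable at `+∞`).  Then
  `w = v ∫_x^∞ v⁻²` is again a zero-free global solution of `w'' = Q w`, and it is RECESSIVE relative
  to `v`: `x w'/w → 1 − μ` (L'Hôpital for `x v⁻² / ∫_x^∞ v⁻² → 2μ − 1`).
* `inversion`.  If `u'' = U u`, `u` zero-free, then `1/u` solves the DARBOUX PARTNER equation
  `(1/u)'' = (2W² − U)(1/u)`, `W = u'/u`, with `x (1/u)'/(1/u) = −x u'/u`.
* `chain_exists` (registered form `ladderExists_chain`).  From a zero-free dominant seed `v` of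
  `V` (`x v'/v → ℓ + 1`): the recessive seeds `u₀ = v ∫v⁻²`, `u_{k+1} = u_k⁻¹ ∫ u_k²` and partner
  potentials `U₀ = V`, `U_{k+1} = 2 (u_k'/u_k)² − U_k` satisfy, for `k ≤ ℓ`: `u_k'' = U_k u_k`,
  `u_k` zero-free, `x u_k'/u_k → k − ℓ`, `U_k ∈ C¹`.  Nothing ever vanishes because each rung is a
  reduction of order, not a shooting problem.
(Hartman, *Ordinary Differential Equations*, Ch. XI §6 (Riccati/Darboux), Ch. IV §8 (reduction of
order); folklore.)
-/

-- `Summit.<S>.<S>` repeats a namespace component by design (D-0017); off here as in the lakefile.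
set_option linter.dupNamespace false

namespace Summit.FinalStateConjecture.FinalStateConjecture.Theorems.CrumPeelingRecessiveTower

open Filter Set Topology MeasureTheory Literature.Analysis.ODE

/-! ### Growth of a solution from its logarithmic derivative -/

/-- If `v` is zero-free with `x v'/v → μ > 1/2`, then `v⁻² ≤ C x^{−(μ + 1/2)}` beyond some `X > 0`
(`log |v| − μ' log x` is nondecreasing once `x v'/v ≥ μ' = (μ + 1/2)/2`). [folklore] -/
theorem inv_sq_le_rpow {Q v : ℝ → ℝ} {μ : ℝ} (hv : IsSchrodingerSol Q v) (hv0 : ∀ x, v x ≠ 0)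
    (hμ : 1 / 2 < μ) (hlim : Tendsto (fun x => x * (deriv v x / v x)) atTop (𝓝 μ)) :
    ∃ X C : ℝ, 0 < X ∧ 0 < C ∧ ∀ x, X ≤ x → (v x ^ 2)⁻¹ ≤ C * x ^ (-(μ + 1 / 2)) := by
  set μ' : ℝ := (μ + 1 / 2) / 2 with hμ'
  have hev : ∀ᶠ x in atTop, μ' < x * (deriv v x / v x) :=
    (tendsto_order.1 hlim).1 _ (by rw [hμ']; linarith)
  obtain ⟨X, hX⟩ := eventually_atTop.1 (hev.and (eventually_ge_atTop 1))
  have hX0 : 0 < X := lt_of_lt_of_le one_pos (hX X le_rfl).2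
  -- `ψ = log |v| - μ' log x` is nondecreasing on `[X, ∞)`
  have hψ : ∀ x, X ≤ x → HasDerivAt (fun x => Real.log (v x) - μ' * Real.log x)
      (deriv v x / v x - μ' * x⁻¹) x := fun x hx =>
    ((hv.hasDerivAt x).log (hv0 x)).sub
      ((Real.hasDerivAt_log (hX0.trans_le hx).ne').const_mul μ')
  have hmono : MonotoneOn (fun x => Real.log (v x) - μ' * Real.log x) (Ici X) := by
    refine monotoneOn_of_hasDerivWithinAt_nonneg (convex_Ici X)
      (fun x hx => (hψ x hx).continuousAt.continuousWithinAt)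
      (fun x hx => (hψ x (interior_subset hx)).hasDerivWithinAt) fun x hx => ?_
    rw [interior_Ici] at hx
    have hx' : X ≤ x := le_of_lt hx
    have hx0 : 0 < x := hX0.trans_le hx'
    have h1 : μ' < x * (deriv v x / v x) := (hX x hx').1
    have h2 : deriv v x / v x - μ' * x⁻¹ = (x * (deriv v x / v x) - μ') / x := by
      field_simp
    rw [h2]
    exact div_nonneg (by linarith) hx0.le
  set K : ℝ := Real.log (v X) - μ' * Real.log X with hK
  have key : ∀ x, X ≤ x → Real.exp (2 * K) * x ^ (μ + 1 / 2) ≤ v x ^ 2 := by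
    intro x hx
    have hx0 : 0 < x := hX0.trans_le hx
    have h1 : K ≤ Real.log (v x) - μ' * Real.log x := hmono self_mem_Ici hx hx
    have h2 : v x ^ 2 = Real.exp (2 * Real.log (v x)) := by
      rw [show (2 : ℝ) * Real.log (v x) = Real.log (v x) + Real.log (v x) by ring, Real.exp_add,
        Real.exp_log_eq_abs (hv0 x), ← sq, sq_abs]
    have h3 : x ^ (μ + 1 / 2) = Real.exp (2 * μ' * Real.log x) := by
      rw [Real.rpow_def_of_pos hx0, hμ']
      congr 1
      ring
    rw [h2, h3, ← Real.exp_add]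
    exact Real.exp_le_exp.2 (by linarith)
  refine ⟨X, Real.exp (-(2 * K)), hX0, Real.exp_pos _, fun x hx => ?_⟩
  have hx0 : 0 < x := hX0.trans_le hx
  rw [Real.rpow_neg hx0.le, Real.exp_neg, ← mul_inv]
  exact inv_anti₀ (by positivity) (key x hx)

/-- Under the same hypotheses `v⁻²` is integrable on every right half-line. [folklore] -/
theorem integrableOn_inv_sq {Q v : ℝ → ℝ} {μ : ℝ} (hv : IsSchrodingerSol Q v) (hv0 : ∀ x, v x ≠ 0)
    (hμ : 1 / 2 < μ) (hlim : Tendsto (fun x => x * (deriv v x / v x)) atTop (𝓝 μ)) (a : ℝ) :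
    IntegrableOn (fun y => (v y ^ 2)⁻¹) (Ioi a) := by
  obtain ⟨X, C, hX, -, hle⟩ := inv_sq_le_rpow hv hv0 hμ hlim
  have hcont : Continuous fun y => (v y ^ 2)⁻¹ :=
    (hv.continuous.pow 2).inv₀ fun y => pow_ne_zero 2 (hv0 y)
  have hfar : IntegrableOn (fun y => (v y ^ 2)⁻¹) (Ioi (max a X)) := by
    have hint : IntegrableOn (fun y : ℝ => C * y ^ (-(μ + 1 / 2))) (Ioi (max a X)) :=
      (integrableOn_Ioi_rpow_of_lt (by linarith) (hX.trans_le (le_max_right a X))).const_mul C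
    refine hint.mono' hcont.aestronglyMeasurable ?_
    refine (ae_restrict_iff' measurableSet_Ioi).2 (Eventually.of_forall fun y hy => ?_)
    rw [Real.norm_eq_abs, abs_of_nonneg (inv_nonneg.2 (sq_nonneg _))]
    exact hle y ((le_max_right a X).trans (le_of_lt hy))
  have h := (hcont.integrableOn_Ioc (a := a) (b := max a X)).union hfar
  rwa [Ioc_union_Ioi_eq_Ioi (le_max_left a X)] at h

/-! ### Reduction of order at `+∞` -/

/-- **Reduction of order.** Let `v` be a zero-free global solution of `v'' = Q v` with
`x v'/v → μ > 1/2`.  Then `w(x) = v(x) ∫_{(x,∞)} v⁻²` is a zero-free global solution of `w'' = Q w`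
with `x w'/w → 1 − μ`. [folklore] -/
theorem reduction_step {Q v : ℝ → ℝ} {μ : ℝ} (hv : IsSchrodingerSol Q v) (hv0 : ∀ x, v x ≠ 0)
    (hμ : 1 / 2 < μ) (hlim : Tendsto (fun x => x * (deriv v x / v x)) atTop (𝓝 μ)) :
    IsSchrodingerSol Q (fun x => v x * ∫ y in Ioi x, (v y ^ 2)⁻¹) ∧
      (∀ x, v x * ∫ y in Ioi x, (v y ^ 2)⁻¹ ≠ 0) ∧
      Tendsto (fun x => x * (deriv (fun x => v x * ∫ y in Ioi x, (v y ^ 2)⁻¹) x /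
        (v x * ∫ y in Ioi x, (v y ^ 2)⁻¹))) atTop (𝓝 (1 - μ)) := by
  set J : ℝ → ℝ := fun x => ∫ y in Ioi x, (v y ^ 2)⁻¹ with hJdef
  have hint := integrableOn_inv_sq hv hv0 hμ hlim
  have hcont : Continuous fun y => (v y ^ 2)⁻¹ :=
    (hv.continuous.pow 2).inv₀ fun y => pow_ne_zero 2 (hv0 y)
  -- the tail `J`: derivative, sign, limit
  have hJ : ∀ x, HasDerivAt J (-(v x ^ 2)⁻¹) x := fun x =>
    hasDerivAt_integral_Ioi (X := x - 1) hcont.continuousOn (hint (x - 1)) (by linarith)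
  have hJpos : ∀ x, 0 < J x := fun x => by
    have h := (setIntegral_pos_iff_support_of_nonneg_ae
      (Eventually.of_forall fun y => inv_nonneg.2 (sq_nonneg (v y))) (hint x)).2
    refine h ?_
    have hsupp : Function.support (fun y => (v y ^ 2)⁻¹) = univ := by
      ext y
      simp [hv0 y]
    rw [hsupp, univ_inter, Real.volume_Ioi]
    simp
  have hJ0 : Tendsto J atTop (𝓝 0) := by
    have h := intervalIntegral_tendsto_integral_Ioi 0 (hint 0) tendsto_id
    have h2 := (tendsto_const_nhds (x := ∫ y in Ioi (0 : ℝ), (v y ^ 2)⁻¹)).sub h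
    rw [sub_self] at h2
    refine h2.congr' ?_
    filter_upwards [eventually_ge_atTop (0 : ℝ)] with x hx
    simp only [id_eq]
    rw [← intervalIntegral.integral_Ioi_sub_Ioi (hint 0) hx, sub_sub_cancel]
  -- the new solution `w = v J`
  have hw : ∀ x, HasDerivAt (fun x => v x * J x) (deriv v x * J x - (v x)⁻¹) x := fun x => by
    refine ((hv.hasDerivAt x).fun_mul (hJ x)).congr_deriv ?_
    have := hv0 x
    field_simp
    ring
  have hdw : deriv (fun x => v x * J x) = fun x => deriv v x * J x - (v x)⁻¹ :=
    funext fun x => (hw x).deriv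
  have hw' : ∀ x, HasDerivAt (fun x => deriv v x * J x - (v x)⁻¹) (Q x * (v x * J x)) x := by
    intro x
    refine (((hv.hasDerivAt_deriv x).fun_mul (hJ x)).fun_sub
      ((hv.hasDerivAt x).fun_inv (hv0 x))).congr_deriv ?_
    have := hv0 x
    field_simp
    ring
  have hsol : IsSchrodingerSol Q (fun x => v x * J x) := by
    refine ⟨fun x => (hw x).differentiableAt, fun x => ?_⟩
    rw [hdw]
    exact hw' x
  have hne : ∀ x, v x * J x ≠ 0 := fun x => mul_ne_zero (hv0 x) (hJpos x).ne'
  -- asymptotics: `x v⁻² / J → 2μ - 1` by L'Hôpital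
  obtain ⟨X, C, hX, hC, hle⟩ := inv_sq_le_rpow hv hv0 hμ hlim
  have hxw : Tendsto (fun x => x * (v x ^ 2)⁻¹) atTop (𝓝 0) := by
    have hup : Tendsto (fun x : ℝ => C * x ^ (-(μ - 1 / 2))) atTop (𝓝 (C * 0)) :=
      (tendsto_rpow_neg_atTop (by linarith)).const_mul C
    rw [mul_zero] at hup
    refine tendsto_of_tendsto_of_tendsto_of_le_of_le' tendsto_const_nhds hup ?_ ?_
    · filter_upwards [eventually_ge_atTop (0 : ℝ)] with x hx
      exact mul_nonneg hx (inv_nonneg.2 (sq_nonneg _))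
    · filter_upwards [eventually_ge_atTop X] with x hx
      have hx0 : 0 < x := hX.trans_le hx
      calc x * (v x ^ 2)⁻¹ ≤ x * (C * x ^ (-(μ + 1 / 2))) :=
            mul_le_mul_of_nonneg_left (hle x hx) hx0.le
        _ = C * x ^ (-(μ - 1 / 2)) := by
            rw [show -(μ - 1 / 2) = 1 + -(μ + 1 / 2) by ring, Real.rpow_add hx0, Real.rpow_one]
            ring
  have hsq : ∀ x, HasDerivAt (fun x => (v x ^ 2)⁻¹) (-(2 * v x * deriv v x) / (v x ^ 2) ^ 2) x :=
    fun x => by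
    have h := ((hv.hasDerivAt x).fun_pow 2).fun_inv (pow_ne_zero 2 (hv0 x))
    refine h.congr_deriv ?_
    simp
  have hquot : Tendsto (fun x => x * (v x ^ 2)⁻¹ / J x) atTop (𝓝 (2 * μ - 1)) := by
    refine HasDerivAt.lhopital_zero_atTop
      (f' := fun x => (v x ^ 2)⁻¹ * (1 - 2 * (x * (deriv v x / v x))))
      (g' := fun x => -(v x ^ 2)⁻¹)
      (Eventually.of_forall fun x => ?_) (Eventually.of_forall hJ)
      (Eventually.of_forall fun x => neg_ne_zero.2 (inv_ne_zero (pow_ne_zero 2 (hv0 x))))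
      hxw hJ0 ?_
    · refine ((hasDerivAt_id' x).fun_mul (hsq x)).congr_deriv ?_
      have := hv0 x
      field_simp
      ring
    · have heq : (fun x => (v x ^ 2)⁻¹ * (1 - 2 * (x * (deriv v x / v x))) / -(v x ^ 2)⁻¹)
          = fun x => 2 * (x * (deriv v x / v x)) - 1 := by
        funext x
        have h := hv0 x
        have h' := inv_ne_zero (pow_ne_zero 2 (hv0 x))
        field_simp
        ring
      rw [heq]
      have h := (hlim.const_mul 2).sub_const 1
      exact h
  -- `x w'/w = x v'/v - x v⁻²/J`
  have hid : ∀ x, x * (deriv (fun x => v x * J x) x / (v x * J x))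
      = x * (deriv v x / v x) - x * (v x ^ 2)⁻¹ / J x := by
    intro x
    rw [hdw]
    have h1 := hv0 x
    have h2 := (hJpos x).ne'
    field_simp
  have hfin : Tendsto (fun x => x * (deriv v x / v x) - x * (v x ^ 2)⁻¹ / J x) atTop
      (𝓝 (μ - (2 * μ - 1))) := hlim.sub hquot
  rw [show μ - (2 * μ - 1) = 1 - μ by ring] at hfin
  exact ⟨hsol, hne, hfin.congr fun x => (hid x).symm⟩

/-! ### The Darboux partner and the chain -/

/-- **Inversion.** If `u'' = U u` with `u` zero-free, then `1/u` is a global solution of the Darboux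
partner equation `(1/u)'' = (2 (u'/u)² − U) (1/u)`, and `x (1/u)'/(1/u) = −x u'/u`. [folklore] -/
theorem inversion {U u : ℝ → ℝ} (hu : IsSchrodingerSol U u) (hu0 : ∀ x, u x ≠ 0) :
    IsSchrodingerSol (fun x => 2 * (deriv u x / u x) ^ 2 - U x) (fun x => (u x)⁻¹) ∧
      ∀ x, x * (deriv (fun x => (u x)⁻¹) x / (u x)⁻¹) = -(x * (deriv u x / u x)) := by
  have h1 : ∀ x, HasDerivAt (fun x => (u x)⁻¹) (-(deriv u x) / u x ^ 2) x := fun x =>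
    (hu.hasDerivAt x).fun_inv (hu0 x)
  have hd : deriv (fun x => (u x)⁻¹) = fun x => -(deriv u x) / u x ^ 2 :=
    funext fun x => (h1 x).deriv
  have h2 : ∀ x, HasDerivAt (fun x => -(deriv u x) / u x ^ 2)
      ((2 * (deriv u x / u x) ^ 2 - U x) * (u x)⁻¹) x := fun x => by
    have h := (hu.hasDerivAt_deriv x).fun_neg.fun_div ((hu.hasDerivAt x).fun_pow 2)
      (pow_ne_zero 2 (hu0 x))
    refine h.congr_deriv ?_
    have := hu0 x
    simp only [Nat.cast_ofNat, Nat.add_one_sub_one, pow_one]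
    field_simp
    ring
  refine ⟨⟨fun x => (h1 x).differentiableAt, fun x => ?_⟩, fun x => ?_⟩
  · rw [hd]
    exact h2 x
  · rw [hd]
    have := hu0 x
    field_simp

/-- **The recessive chain.** Let `V ∈ C¹` and let `v` be a zero-free global solution of
`v'' = V v` with `x v'/v → ℓ + 1` (a dominant seed).  Then there are seeds `u : ℕ → ℝ → ℝ` and
partner potentials `U : ℕ → ℝ → ℝ` with `U 0 = V`, `U (k+1) = 2 (u_k'/u_k)² − U k` and, for all
`k ≤ ℓ`: `u_k'' = U_k u_k` globally, `u_k` zero-free, `x u_k'/u_k → k − ℓ` (recessive normalisation)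
and `U_k ∈ C¹`.  Construction: `u₀ = v ∫v⁻²`, `u_{k+1} = u_k⁻¹ ∫ (u_k⁻¹)⁻²` (inversion followed by
reduction of order), so no seed ever vanishes. [folklore] -/
theorem chain_exists {V v : ℝ → ℝ} (hV : ContDiff ℝ 1 V) (hv : IsSchrodingerSol V v)
    (hv0 : ∀ x, v x ≠ 0) {ℓ : ℕ}
    (hlim : Tendsto (fun x => x * (deriv v x / v x)) atTop (𝓝 ((ℓ : ℝ) + 1))) :
    ∃ u U : ℕ → ℝ → ℝ, U 0 = V ∧
      (∀ k, U (k + 1) = fun x => 2 * (deriv (u k) x / u k x) ^ 2 - U k x) ∧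
      ∀ k, k ≤ ℓ → IsSchrodingerSol (U k) (u k) ∧ (∀ x, u k x ≠ 0) ∧
        Tendsto (fun x => x * (deriv (u k) x / u k x)) atTop (𝓝 ((k : ℝ) - ℓ)) ∧
        ContDiff ℝ 1 (U k) := by
  -- the sequence of pairs (seed, partner potential)
  obtain ⟨seq, h0, hS⟩ : ∃ seq : ℕ → (ℝ → ℝ) × (ℝ → ℝ),
      seq 0 = (fun x => v x * ∫ y in Ioi x, (v y ^ 2)⁻¹, V) ∧
      ∀ k, seq (k + 1) =
        (fun x => ((seq k).1 x)⁻¹ * ∫ y in Ioi x, (((seq k).1 y)⁻¹ ^ 2)⁻¹,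
          fun x => 2 * (deriv (seq k).1 x / (seq k).1 x) ^ 2 - (seq k).2 x) := by
    let step : (ℝ → ℝ) × (ℝ → ℝ) → (ℝ → ℝ) × (ℝ → ℝ) := fun p =>
      (fun x => (p.1 x)⁻¹ * ∫ y in Ioi x, ((p.1 y)⁻¹ ^ 2)⁻¹,
        fun x => 2 * (deriv p.1 x / p.1 x) ^ 2 - p.2 x)
    exact ⟨fun k => step^[k] (fun x => v x * ∫ y in Ioi x, (v y ^ 2)⁻¹, V), rfl,
      fun k => Function.iterate_succ_apply' step k _⟩
  refine ⟨fun k => (seq k).1, fun k => (seq k).2, by dsimp only; rw [h0],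
    fun k => by dsimp only; rw [hS k], fun k => ?_⟩
  induction k with
  | zero =>
    intro _
    dsimp only
    have hμ : (1 : ℝ) / 2 < (ℓ : ℝ) + 1 := by
      have : (0 : ℝ) ≤ ℓ := Nat.cast_nonneg ℓ
      linarith
    obtain ⟨hsol, hne, hl⟩ := reduction_step hv hv0 hμ hlim
    rw [h0]
    refine ⟨hsol, hne, ?_, hV⟩
    rw [show ((0 : ℕ) : ℝ) - ℓ = 1 - ((ℓ : ℝ) + 1) by push_cast; ring]
    exact hl
  | succ k ih =>
    intro hk
    dsimp only at ih ⊢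
    obtain ⟨hsol, hne, hl, hC⟩ := ih (Nat.le_of_succ_le hk)
    obtain ⟨hinv, hinvid⟩ := inversion hsol hne
    have hne' : ∀ x, ((seq k).1 x)⁻¹ ≠ 0 := fun x => inv_ne_zero (hne x)
    have hl' : Tendsto (fun x => x * (deriv (fun x => ((seq k).1 x)⁻¹) x / ((seq k).1 x)⁻¹))
        atTop (𝓝 ((ℓ : ℝ) - k)) := by
      have h := hl.neg
      rw [show -((k : ℝ) - ℓ) = (ℓ : ℝ) - k by ring] at h
      exact h.congr fun x => (hinvid x).symm
    have hμ : (1 : ℝ) / 2 < (ℓ : ℝ) - k := by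
      have : (k : ℝ) + 1 ≤ ℓ := by exact_mod_cast hk
      linarith
    obtain ⟨hsol', hne'', hl''⟩ := reduction_step hinv hne' hμ hl'
    rw [hS k]
    refine ⟨hsol', hne'', ?_, ?_⟩
    · rw [show ((k + 1 : ℕ) : ℝ) - ℓ = 1 - ((ℓ : ℝ) - k) by push_cast; ring]
      exact hl''
    · have hu1 : ContDiff ℝ 1 (seq k).1 :=
        contDiff_one_iff_deriv.2 ⟨hsol.differentiable, hsol.continuous_deriv⟩
      have hdu1 : ContDiff ℝ 1 (deriv (seq k).1) := by
        refine contDiff_one_iff_deriv.2 ⟨hsol.differentiable_deriv, ?_⟩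
        have hdd : deriv (deriv (seq k).1) = fun x => (seq k).2 x * (seq k).1 x :=
          funext hsol.deriv_deriv
        rw [hdd]
        exact hC.continuous.mul hsol.continuous
      have hW : ContDiff ℝ 1 (fun x => deriv (seq k).1 x / (seq k).1 x) := hdu1.div hu1 hne
      exact (contDiff_const.mul (hW.pow 2)).sub hC

/-- **The recessive chain, registered form** (sub-goal `ladderExists_chain` of
`stub_ladderExists`): see `chain_exists`. [folklore] -/
theorem ladderExists_chain : ∀ (V v : ℝ → ℝ) (ℓ : ℕ), ContDiff ℝ 1 V →
    Literature.Analysis.ODE.IsSchrodingerSol V v → (∀ x, v x ≠ 0) →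
    Filter.Tendsto (fun x => x * (deriv v x / v x)) Filter.atTop (nhds ((ℓ : ℝ) + 1)) →
    ∃ u U : ℕ → ℝ → ℝ, U 0 = V ∧
      (∀ k, U (k + 1) = fun x => 2 * (deriv (u k) x / u k x) ^ 2 - U k x) ∧
      ∀ k, k ≤ ℓ → Literature.Analysis.ODE.IsSchrodingerSol (U k) (u k) ∧ (∀ x, u k x ≠ 0) ∧
        Filter.Tendsto (fun x => x * (deriv (u k) x / u k x)) Filter.atTop (nhds ((k : ℝ) - ℓ)) ∧
        ContDiff ℝ 1 (U k) :=
  fun _ _ _ hV hv hv0 hlim => chain_exists hV hv hv0 hlim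

end Summit.FinalStateConjecture.FinalStateConjecture.Theorems.CrumPeelingRecessiveTower
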